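import Literature.MathematicalPhysics.QuantumLattice.HubbardModel
import Literature.MathematicalPhysics.QuantumLattice.HubbardModelThermodynamicLimitProofs
import Literature.MathematicalPhysics.QuantumLattice.SectorVariationalBounds
import HarnessLib

/-!
# Bootstrap / RDM certificate duality for sector ground-state energies

Trunk T-QLATTICE, family `hubbard`. The abstract half of the many-body-bootstrap / reduced-density-matrix
lower-bound method (X. Han, *Quantum many-body bootstrap*, arXiv:2006.06002 (2020), §2, eq. (3) for `E_lb` —
the lattice / Hubbard version of the matrix-model bootstrap of Han–Hartnoll–Kruthoff, PRL 125 (2020) 041601;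
Barthel–Hübener, PRL 108 (2012)
200404; Mazziotti, PRA 2006; Kull–Schuch–Dive–Navascués, PRX 14 (2024) 021008 §5.3 for the finite-precision
shift of a numerically obtained dual), stated for the tree's sector ground energy
`groundEnergy H N = inf { Re ⟨ψ, H ψ⟩ : ψ N-particle, ‖ψ‖ = 1 }` (`HubbardWave0.groundEnergy`).

* `posSemidef_gramSum`: a PSD Gram matrix `G` over a family of operators `O a` gives the PSD operator
  `Σ_{a,b} G a b • (O a)ᴴ * O b` (the "sum of squares" side of the SDP dual).
* `le_groundEnergy_of_posSemidef_sub_sector`: if `H - c·1 - K ⪰ 0` and the quadratic form of `K` vanishes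
  on the `N`-particle sector, then `c ≤ E₀(N)` (sector nonempty, `N ≤ |ι|`).
* `le_groundEnergy_of_sectorBlock_posSemidef`: the same with the `N`-particle block `H.toBlock p p`,
  `p s := s.card = N`, which is what a finite certificate refers to.
* `le_groundEnergy_of_certificate`: the **rounded certificate** form — block `B`, operators `O a` on the block,
  rational Gram `G ⪰ 0`, residual `R := B - c·1 - Σ G a b • (O a)ᴴ O b` with `R + ε·1 ⪰ 0` ⇒ `c - ε ≤ E₀(N)`.
* `groundEnergy_le_of_trial`: the upper side, a restatement of the tree's variational principle for a unit
  `N`-particle trial vector (exact rational Rayleigh quotients in the numerics).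

All proofs are sorry-free and nothing numerical is asserted here; the file is pure linear algebra over the existing
tree definitions (`HubbardWave0.groundEnergy`, `IsNParticle`, `SectorVariationalBounds` block lemmas). What is
deliberately NOT here: any concrete Hamiltonian, any certificate, any numerics.

## References
* [Han2020Bootstrap] X. Han, *Quantum many-body bootstrap*, arXiv:2006.06002 (2020), §2 (Hubbard model, 1D and 2D).
* [HanHartnollKruthoff2020] X. Han, S. A. Hartnoll, J. Kruthoff, *Bootstrapping matrix quantum mechanics*,
  PRL 125 (2020) 041601, arXiv:2004.10212 (the matrix-model precursor; not the source of the lattice statements).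
* [KullEtAl2024] I. Kull, N. Schuch, B. Dive, M. Navascués, PRX 14 (2024) 021008, arXiv:2212.03014, §5.3.
* [BarthelHubener2012] T. Barthel, R. Hübener, PRL 108 (2012) 200404, arXiv:1106.4966.
* [Tasaki2020] H. Tasaki, *Physics and Mathematics of Quantum Many-Body Systems* (2020), §2.1.
-/

noncomputable section

namespace Literature.MathematicalPhysics.QuantumLattice

open Matrix Finset
open Literature.MathematicalPhysics.QuantumLattice.ThermodynamicLimit
open scoped ComplexOrder

/-! ### The sum-of-squares side -/

section Gram

variable {n κ : Type*} [Fintype n] [Fintype κ]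

/-- `⟨ψ, (Oᴴ O') ψ⟩ = ⟨O ψ, O' ψ⟩`. [folklore] -/
theorem star_dotProduct_conjTranspose_mul_mulVec_gram (O O' : Matrix n n ℂ) (ψ : n → ℂ) :
    star ψ ⬝ᵥ (Oᴴ * O') *ᵥ ψ = star (O *ᵥ ψ) ⬝ᵥ (O' *ᵥ ψ) := by
  rw [star_mulVec, ← mulVec_mulVec, dotProduct_mulVec]

/-- The quadratic form of `G` as a double sum. [folklore] -/
theorem star_dotProduct_mulVec_eq_sum (G : Matrix κ κ ℂ) (w : κ → ℂ) :
    star w ⬝ᵥ G *ᵥ w = ∑ a, ∑ b, star (w a) * G a b * w b := by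
  simp only [dotProduct, mulVec, Pi.star_apply, Finset.mul_sum]
  refine Finset.sum_congr rfl fun a _ => Finset.sum_congr rfl fun b _ => ?_
  ring

/-- Moving the innermost of three finite sums to the front. [folklore] -/
theorem sum_sum_sum_comm_right (F : κ → κ → n → ℂ) :
    ∑ a, ∑ b, ∑ s, F a b s = ∑ s, ∑ a, ∑ b, F a b s :=
  calc ∑ a, ∑ b, ∑ s, F a b s = ∑ a, ∑ s, ∑ b, F a b s :=
        Finset.sum_congr rfl fun _ _ => Finset.sum_comm
    _ = ∑ s, ∑ a, ∑ b, F a b s := Finset.sum_comm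

/-- The quadratic form of a Gram sum is a sum of quadratic forms of `G`:
`⟨ψ, (Σ_{a,b} G a b (O a)ᴴ O b) ψ⟩ = Σ_s ⟨w_s, G w_s⟩` with `w_s a = (O a ψ) s`. [folklore] -/
theorem star_dotProduct_gramSum_mulVec (O : κ → Matrix n n ℂ) (G : Matrix κ κ ℂ) (ψ : n → ℂ) :
    star ψ ⬝ᵥ (∑ a, ∑ b, G a b • ((O a)ᴴ * O b)) *ᵥ ψ =
        ∑ s, star (fun a => (O a *ᵥ ψ) s) ⬝ᵥ G *ᵥ (fun a => (O a *ᵥ ψ) s) := by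
  simp only [sum_mulVec, smul_mulVec, dotProduct_sum, dotProduct_smul,
    star_dotProduct_conjTranspose_mul_mulVec_gram, smul_eq_mul]
  simp only [star_dotProduct_mulVec_eq_sum]
  simp only [dotProduct, Pi.star_apply, Finset.mul_sum]
  rw [sum_sum_sum_comm_right]
  refine Finset.sum_congr rfl fun s _ => Finset.sum_congr rfl fun a _ =>
    Finset.sum_congr rfl fun b _ => ?_
  ring

/-- **Gram sums are positive semidefinite**: for a PSD `G : Matrix κ κ ℂ` and any family
`O : κ → Matrix n n ℂ`, `Σ_{a,b} G a b • (O a)ᴴ * O b ⪰ 0`. This is the "dual functional ⇒ operator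
inequality" step of the many-body bootstrap. [cite: Han2020Bootstrap, §2] -/
theorem posSemidef_gramSum [DecidableEq n] (O : κ → Matrix n n ℂ) {G : Matrix κ κ ℂ}
    (hG : G.PosSemidef) :
    (∑ a, ∑ b, G a b • ((O a)ᴴ * O b)).PosSemidef := by
  refine PosSemidef.of_dotProduct_mulVec_nonneg ?_ ?_
  · have hGH : ∀ a b, star (G a b) = G b a := fun a b => by
      have := congrFun (congrFun hG.1 b) a
      simpa [conjTranspose_apply] using this
    unfold IsHermitian
    rw [conjTranspose_sum]
    simp_rw [conjTranspose_sum, conjTranspose_smul, conjTranspose_mul, conjTranspose_conjTranspose, hGH]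
    exact Finset.sum_comm
  · intro ψ
    rw [star_dotProduct_gramSum_mulVec]
    exact Finset.sum_nonneg fun s _ => hG.dotProduct_mulVec_nonneg _

end Gram

/-! ### The sector lower bound -/

section Sector

variable {ι : Type*} [LinearOrder ι] [Fintype ι]

/-- **PSD dual functional ⇒ sector lower bound (pointwise form).** If `H - c·1 - K ⪰ 0` and the quadratic
form of `K` vanishes on `N`-particle vectors (e.g. `K = X (N̂ - N)` or its Hermitian part), then every
unit `N`-particle `ψ` has `Re ⟨ψ, H ψ⟩ ≥ c`. [cite: Han2020Bootstrap, §2] -/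
theorem le_re_expect_of_posSemidef_sub_sector {H K : Matrix (Finset ι) (Finset ι) ℂ} {N : ℕ} {c : ℝ}
    (hK : ∀ ψ : Fock ι, IsNParticle N ψ → star ψ ⬝ᵥ K *ᵥ ψ = 0)
    (h : (H - (c : ℂ) • (1 : Matrix (Finset ι) (Finset ι) ℂ) - K).PosSemidef)
    {ψ : Fock ι} (hψN : IsNParticle N ψ) (hψ1 : star ψ ⬝ᵥ ψ = 1) :
    c ≤ (Literature.MathematicalPhysics.QuantumLattice.expect H ψ).re := by
  have h0 := h.dotProduct_mulVec_nonneg ψ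
  rw [sub_mulVec, sub_mulVec, dotProduct_sub, dotProduct_sub, smul_mulVec, one_mulVec, dotProduct_smul,
    hψ1, hK ψ hψN] at h0
  obtain ⟨hre, -⟩ := Complex.nonneg_iff.mp h0
  simp only [Complex.sub_re, smul_eq_mul, mul_one, Complex.ofReal_re, sub_zero] at hre
  unfold Literature.MathematicalPhysics.QuantumLattice.expect
  linarith

/-- **PSD dual functional ⇒ sector ground-energy lower bound.** With the hypotheses of
`le_re_expect_of_posSemidef_sub_sector` and a nonempty sector (`N ≤ |ι|`), `c ≤ E₀(N)`.
[cite: Han2020Bootstrap, §2] -/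
theorem le_groundEnergy_of_posSemidef_sub_sector {H K : Matrix (Finset ι) (Finset ι) ℂ} {N : ℕ}
    (hN : N ≤ Fintype.card ι) {c : ℝ}
    (hK : ∀ ψ : Fock ι, IsNParticle N ψ → star ψ ⬝ᵥ K *ᵥ ψ = 0)
    (h : (H - (c : ℂ) • (1 : Matrix (Finset ι) (Finset ι) ℂ) - K).PosSemidef) :
    c ≤ Literature.MathematicalPhysics.QuantumLattice.groundEnergy H N := by
  unfold Literature.MathematicalPhysics.QuantumLattice.groundEnergy
  refine le_csInf (groundEnergySet_nonempty H hN) ?_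
  rintro E ⟨ψ, hψN, hψ1, rfl⟩
  exact le_re_expect_of_posSemidef_sub_sector hK h hψN hψ1

/-- **Block form.** A PSD certificate on the `N`-particle block `H.toBlock (fun s : Finset ι => s.card = N) (fun s : Finset ι => s.card = N)`
(the matrix a finite computation actually handles) bounds the sector ground energy:
`B - c·1 ⪰ 0 ⇒ c ≤ E₀(N)`. [folklore] -/
theorem le_groundEnergy_of_sectorBlock_posSemidef (H : Matrix (Finset ι) (Finset ι) ℂ) {N : ℕ}
    (hN : N ≤ Fintype.card ι) {c : ℝ}
    (h : (H.toBlock (fun s : Finset ι => s.card = N) (fun s : Finset ι => s.card = N) - (c : ℂ) • 1).PosSemidef) :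
    c ≤ Literature.MathematicalPhysics.QuantumLattice.groundEnergy H N := by
  unfold Literature.MathematicalPhysics.QuantumLattice.groundEnergy
  refine le_csInf (groundEnergySet_nonempty H hN) ?_
  rintro E ⟨ψ, hψN, hψ1, rfl⟩
  have hsupp : ∀ s : Finset ι, ¬ s.card = N → ψ s = 0 := fun s hs => hψN s hs
  set ψ' : {s : Finset ι // s.card = N} → ℂ := fun s => ψ s.1 with hψ'
  have h0 := h.dotProduct_mulVec_nonneg ψ'
  rw [sub_mulVec, dotProduct_sub, smul_mulVec, one_mulVec, dotProduct_smul, hψ',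
    star_restrict_dotProduct_toBlock_mulVec (fun s : Finset ι => s.card = N) H ψ hsupp,
    star_restrict_dotProduct_restrict (fun s : Finset ι => s.card = N) ψ ψ hsupp, hψ1] at h0
  obtain ⟨hre, -⟩ := Complex.nonneg_iff.mp h0
  simp only [Complex.sub_re, smul_eq_mul, mul_one, Complex.ofReal_re] at hre
  unfold Literature.MathematicalPhysics.QuantumLattice.expect
  linarith

/-- **Rounded certificate ⇒ lower bound.** Let `B` be the `N`-particle block of `H`, `O a` operators on the
block, `G ⪰ 0` a (rational) Gram matrix, and `R := B - c·1 - Σ_{a,b} G a b • (O a)ᴴ O b` the residual of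
the rounded identity. If `R + ε·1 ⪰ 0` (e.g. `ε ≥ ‖R‖`, certified by a Gershgorin / Frobenius bound),
then `c - ε ≤ E₀(N)`. This is the finite-precision shift of [KullEtAl2024, §5.3] in exact
form. [cite: KullEtAl2024, §5.3] -/
theorem le_groundEnergy_of_certificate (H : Matrix (Finset ι) (Finset ι) ℂ) {N : ℕ}
    (hN : N ≤ Fintype.card ι) {κ : Type*} [Fintype κ]
    (O : κ → Matrix {s : Finset ι // s.card = N} {s : Finset ι // s.card = N} ℂ)
    {G : Matrix κ κ ℂ} (hG : G.PosSemidef) {c ε : ℝ}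
    (hR : (H.toBlock (fun s : Finset ι => s.card = N) (fun s : Finset ι => s.card = N) - (c : ℂ) • 1 - ∑ a, ∑ b, G a b • ((O a)ᴴ * O b)
        + (ε : ℂ) • 1).PosSemidef) :
    c - ε ≤ Literature.MathematicalPhysics.QuantumLattice.groundEnergy H N := by
  refine le_groundEnergy_of_sectorBlock_posSemidef H hN ?_
  have h := hR.add (posSemidef_gramSum O hG)
  convert h using 1
  rw [Complex.ofReal_sub, sub_smul]
  abel

/-- **Upper side (trial vector).** For a unit `N`-particle trial vector, `E₀(N) ≤ Re ⟨ψ, H ψ⟩`; used with an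
exact rational `ψ`. Restatement of the tree's variational principle. [cite: Tasaki2020, §2.1] -/
theorem groundEnergy_le_of_trial (H : Matrix (Finset ι) (Finset ι) ℂ) {N : ℕ} {ψ : Fock ι}
    (hψN : IsNParticle N ψ) (hψ1 : star ψ ⬝ᵥ ψ = 1) : groundEnergy H N ≤ (Literature.MathematicalPhysics.QuantumLattice.expect H ψ).re :=
  groundEnergy_le_re_expect H hψN hψ1

end Sector

end Literature.MathematicalPhysics.QuantumLattice

end
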